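import Summits.Langlands.Langlands.Theorems.AbelianSurfaceSerreSerreGSp4SurjectiveSingerDefs
import Literature.NumberTheory.GaloisRepresentations.CompatibleSystemResidualIrreducibility
import Literature.NumberTheory.GaloisRepresentations.InducedGaloisRep
import Literature.NumberTheory.GaloisRepresentations.FramedGaloisRepInduce
import Literature.NumberTheory.Automorphic.ScholzeTorsionGalois

/-!
# Sketch — first lemmas of two crux ideas for `AbelianSurfaceSerre.SerreGSp4WreathFixed`
(stmt-Langlands-18072; crux-ideate round 1, ideator 1).  Nothing here is proved; the defs only have
to elaborate.  They are the `First lemma:` / `Transfer:` fields of the cards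

* `escape-to-full-image`      → `ScarKillsImprimitivity` (first lemma), `EscapeLift`,
                                 `FullImageCompanions`, `SerreGSp4SurjectiveFL` (the transfer `C⁺`)
* `siegel-eisenstein-boundary` → `NoRegularInducedLiftImaginary` (first lemma), `TorsionSerreCM`

The vocabulary of the sibling crux `SerreGSp4Surjective` (line `singer-type-evaporation`, landed
`…SingerDefs`: `FullSymplecticImage`, `ResiduallyAutomorphic`, `ReducesTo`, `cycInv`,
`IsCrystallineWithWeightsAt`, `CompanionAE`, `AutomorphicAE`) is REUSED on purpose: the escape idea
makes the wreath crux a client of the same anchor.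
-/

set_option linter.dupNamespace false

namespace Summit.Langlands.Langlands.Cruxes.SerreGSp4WreathFixed.Sketch

open Literature.NumberTheory.GaloisRepresentations Literature.NumberTheory.Automorphic
  Literature.NumberTheory.PAdicHodge
open scoped NumberField
open IsDedekindDomain Polynomial Field
open Summit.Langlands.Langlands.Cruxes.SerreGSp4Surjective.SingerTypeEvaporation

noncomputable section

/-! ## The crux's clauses, bundled (same bodies as the route decl `SerreGSp4WreathFixed`) -/

/-- `ε̄_p⁻¹` with values in `k`, spelled exactly as in the crux's multiplier. -/
def epsBarInv (p : ℕ) [Fact p.Prime] (k : Type) [Field k] [CharP k p]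
    (g : absoluteGaloisGroup ℚ) : k :=
  (((Units.map (ZMod.castHom (dvd_refl p) k).toMonoidHom
      ((modularCyclotomicCharacter (AlgebraicClosure ℚ)
          (HasEnoughRootsOfUnity.natCard_rootsOfUnity (AlgebraicClosure ℚ) p)).comp
        (MulSemiringAction.toRingAut (absoluteGaloisGroup ℚ) (AlgebraicClosure ℚ)) g))⁻¹ : kˣ) : k)

/-- The PINNED multiplier `ε_p^{-(1+2s)}` of the crux's conclusion, pushed into `ℚ̄_p`. -/
def pinnedMult (p : ℕ) [Fact p.Prime] (s : ℕ) (g : absoluteGaloisGroup ℚ) : PadicAlgCl p :=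
  algebraMap ℚ_[p] (PadicAlgCl p)
    (((((GaloisRep.cyclotomicCharacter ℚ p g)⁻¹ : ℤ_[p]ˣ) : ℤ_[p]) : ℚ_[p]) ^ (1 + 2 * s))

/-- The hypotheses of the crux on the wreath residue `ρ̄ : Γ_ℚ → GL₄(k)` (irreducible; symplectic
with multiplier `ε̄⁻¹`; triangular with distinct diagonal characters at `p`; image of order
`|Δ_p ⋊ C₂|`; irreducible on `Γ_{ℚ(ζ_p)}`; reducible on some quadratic `K`), verbatim. -/
def WreathHyp (p : ℕ) [Fact p.Prime] (k : Type) [Field k] [CharP k p] [IsAlgClosed k]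
    [TopologicalSpace k] [DiscreteTopology k] (ρb : FramedGaloisRep ℚ k 4) : Prop :=
  ρb.toGaloisRep.IsIrreducible ∧
  ρb.IsSymplecticWithMultiplierFun (epsBarInv p k) ∧
  (∀ v : HeightOneSpectrum (𝓞 ℚ), ((p : ℕ) : 𝓞 ℚ) ∈ v.asIdeal →
    ∃ g : Matrix.GeneralLinearGroup (Fin 4) k,
      (∀ (τ : absoluteGaloisGroup (v.adicCompletion ℚ)) (i j : Fin 4), j < i →
        (g * ρb.toLocal v τ * g⁻¹).val i j = 0) ∧
      ∀ i j : Fin 4, i ≠ j → ∃ τ : absoluteGaloisGroup (v.adicCompletion ℚ),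
        (g * ρb.toLocal v τ * g⁻¹).val i i ≠ (g * ρb.toLocal v τ * g⁻¹).val j j) ∧
  Nat.card ρb.toMonoidHom.range = 2 * p ^ 2 * (p - 1) * (p ^ 2 - 1) ^ 2 ∧
  (ρb.restrictField (CyclotomicField p ℚ)).toGaloisRep.IsIrreducible ∧
  (∃ (K : Type) (_ : Field K) (_ : NumberField K),
    Module.finrank ℚ K = 2 ∧ ¬ (ρb.restrictField K).toGaloisRep.IsIrreducible)

/-- The crux's REDUCTION DEVICE to the algebraically closed `k` (global characteristic-polynomial
form; implies the crux's a.e.-Frobenius form): integral characteristic polynomials of the `p`-adic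
`r` reduce under `red` to those of `ρ̄`. -/
def ReducesToK (p : ℕ) [Fact p.Prime] {k : Type} [Field k] [TopologicalSpace k]
    (red : Valued.integer (PadicAlgCl p) →+* k)
    (r : FramedGaloisRep ℚ (PadicAlgCl p) 4) (ρb : FramedGaloisRep ℚ k 4) : Prop :=
  ∀ g : absoluteGaloisGroup ℚ, ∃ P : Polynomial (Valued.integer (PadicAlgCl p)),
    P.map (Valued.integer (PadicAlgCl p)).subtype = FramedRep.charpoly r g ∧
      P.map red = FramedRep.charpoly ρb g

/-- A REGULAR-UNIPOTENT certificate at the finite place `v`: some element of the decomposition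
group at `v` acts through `r` by `u` with `(u-1)^4 = 0 ≠ (u-1)^3` (one Jordan block) — the
Steinberg scar / an element of FKP's big image `⊇ Ĝ^{der}(𝒪')`. -/
def HasRegularUnipotentAt {p : ℕ} [Fact p.Prime] (r : FramedGaloisRep ℚ (PadicAlgCl p) 4)
    (v : HeightOneSpectrum (𝓞 ℚ)) : Prop :=
  ∃ τ : absoluteGaloisGroup (v.adicCompletion ℚ),
    ((r.toLocal v τ).val - 1) ^ 4 = 0 ∧ ((r.toLocal v τ).val - 1) ^ 3 ≠ 0

/-! ## Card `escape-to-full-image` -/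

/-- **FIRST LEMMA (provable now, pure linear algebra + index two).** An irreducible
`r : Γ_ℚ → GL₄(ℚ̄_p)` whose image contains a regular unipotent element stays irreducible on every
quadratic field: if `r|_K = U ⊕ U'` with `dim U = dim U' = 2` (Clifford, landed p157618), then `u²`
(which lies in `r(Γ_K)`, `Γ_K` being normal of index `2`) satisfies `(u²-1)² = 0`, contradicting
`(u²-1)³ ≠ 0` for the square of a regular unipotent in characteristic `0`.  So an escaped lift is
NOT induced from any quadratic field — the wreath structure is killed in characteristic `0`. -/
def ScarKillsImprimitivity : Prop :=
  ∀ (p : ℕ) [Fact p.Prime] (r : FramedGaloisRep ℚ (PadicAlgCl p) 4),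
    r.toGaloisRep.IsIrreducible →
    (∃ v : HeightOneSpectrum (𝓞 ℚ), HasRegularUnipotentAt r v) →
    ∀ (K : Type) [Field K] [NumberField K], Module.finrank ℚ K = 2 →
      (r.restrictField K).toGaloisRep.IsIrreducible

/-- **ESCAPE LIFT (Fakhruddin–Khare–Patrikis 2021 Thm. A for `G = GSp₄`, `F = ℚ`, plus local
lifts).**  For `p` large, every wreath residue `ρ̄` of the crux admits a `p`-adic lift `r` which is
symplectic with the PINNED multiplier `ε^{-(1+2s)}`, `p-1 ∣ s`, Greenberg-ordinary of injective
shape at `p`, unramified almost everywhere, reduces to `ρ̄` under `red`, and carries a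
regular-unipotent certificate at some `v ∤ p` (Steinberg scar at a Chebotarev prime split in `K`
with `ρ̄(Frob) ∼ (diag(a, aq³), diag(aq, aq²))`, or simply an element of FKP's open image
`⊇ Ĝ^{der}(𝒪')`).  By `ScarKillsImprimitivity`, `r` is induced from NO quadratic field, although
`ρ̄` is. -/
def EscapeLift : Prop :=
  ∃ P₁ : ℕ, ∀ (p : ℕ) [Fact p.Prime], P₁ ≤ p →
    ∀ (k : Type) [Field k] [CharP k p] [IsAlgClosed k] [TopologicalSpace k] [DiscreteTopology k]
      (red : Valued.integer (PadicAlgCl p) →+* k) (ρb : FramedGaloisRep ℚ k 4),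
      WreathHyp p k ρb →
      ∃ (s : ℕ) (r : FramedGaloisRep ℚ (PadicAlgCl p) 4),
        (p - 1) ∣ s ∧
        r.IsSymplecticWithMultiplierFun (pinnedMult p s) ∧
        (∀ v : HeightOneSpectrum (𝓞 ℚ), ((p : ℕ) : 𝓞 ℚ) ∈ v.asIdeal →
          ∃ a : Fin 4 → ℕ, Function.Injective a ∧ r.IsGreenbergOrdinaryOfShapeAt v a) ∧
        (∀ᶠ v : HeightOneSpectrum (𝓞 ℚ) in Filter.cofinite, r.IsUnramifiedAt v) ∧
        ReducesToK p red r ρb ∧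
        ∃ v : HeightOneSpectrum (𝓞 ℚ), ((p : ℕ) : 𝓞 ℚ) ∉ v.asIdeal ∧ HasRegularUnipotentAt r v

/-- **FULL-IMAGE COMPANIONS (Larsen–Pink 1992 + Larsen 1995 Thm. 3.17, read on a BLGGT weakly
compatible system).**  Let `r₁ : Γ_ℚ → GL₄(ℚ̄_p)` (in the line: the `ε^s`-twist of the escaped
lift, multiplier exactly `ε_p⁻¹`) be the `(p, ι₀)`-member of a regular weakly compatible system `𝓡`,
carry a regular-unipotent certificate, and reduce to a wreath residue (so its Zariski closure is
irreducible, contains a regular unipotent and is not a principal `SL₂`: it contains `Sp₄`).  Then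
for primes `ℓ` UNBOUNDED ABOVE some member `𝓡 ℓ ι` reduces to an `𝔽_ℓ`-valued `ρ'` whose image is
ALL of `GSp(J)(𝔽_ℓ)` (the sibling crux's (H1), verbatim) and is crystalline at `ℓ` with the common
regular weights `H` inside a Fontaine–Laffaille interval. -/
def FullImageCompanions : Prop :=
  ∀ (p : ℕ) [Fact p.Prime] (k : Type) [Field k] [CharP k p] [IsAlgClosed k] [TopologicalSpace k]
    [DiscreteTopology k] (red : Valued.integer (PadicAlgCl p) →+* k) (ρb : FramedGaloisRep ℚ k 4)
    (r₁ : FramedGaloisRep ℚ (PadicAlgCl p) 4)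
    (S : Finset (HeightOneSpectrum (𝓞 ℚ))) (Q : HeightOneSpectrum (𝓞 ℚ) → Polynomial ℂ)
    (H : Multiset ℤ) (ι₀ : PadicAlgCl p ≃+* ℂ)
    (𝓡 : ∀ (ℓ : ℕ) [Fact ℓ.Prime], (PadicAlgCl ℓ ≃+* ℂ) → FramedGaloisRep ℚ (PadicAlgCl ℓ) 4),
    WreathHyp p k ρb → ReducesToK p red r₁ ρb →
    r₁.IsSymplecticWithMultiplierFun (cycInv p) →
    (∃ v : HeightOneSpectrum (𝓞 ℚ), ((p : ℕ) : 𝓞 ℚ) ∉ v.asIdeal ∧ HasRegularUnipotentAt r₁ v) →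
    IsWeaklyCompatibleSystemRat 4 S Q H 𝓡 → H.Nodup → 𝓡 p ι₀ = r₁ →
    ∀ N : ℕ, ∃ (ℓ : ℕ) (_ : Fact ℓ.Prime) (ι : PadicAlgCl ℓ ≃+* ℂ) (ρ' : FramedGaloisRep ℚ (ZMod ℓ) 4)
      (lo hi : ℤ),
      N ≤ ℓ ∧ hi - lo + 2 ≤ (ℓ : ℤ) ∧ (∀ h ∈ H, lo ≤ h ∧ h ≤ hi) ∧
      ReducesTo ℓ (𝓡 ℓ ι) ρ' ∧ FullSymplecticImage ℓ ρ' ∧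
      (𝓡 ℓ ι).IsSymplecticWithMultiplierFun (cycInv ℓ) ∧
      IsCrystallineWithWeightsAt ℓ H (𝓡 ℓ ι)

/-- **THE TRANSFER `C⁺` — Serre for `GSp₄/ℚ` at FULL-IMAGE residues in FONTAINE–LAFFAILLE weight
(`SerreGSp4SurjectiveFL`).**  For `ℓ` large, every `ρ' : Γ_ℚ → GL₄(𝔽_ℓ)` with image ALL of
`GSp(J)(𝔽_ℓ)` for an alternating `J` preserved up to `ε̄_ℓ⁻¹` (the sibling crux's (H1), verbatim)
which IS the reduction of some `ℓ`-adic symplectic-`ε_ℓ⁻¹` representation crystalline at `ℓ` with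
regular weights in an interval of length `≤ ℓ - 2`, is residually automorphic from a potentially
diagonalisable polarised source (the sibling line's `ResiduallyAutomorphic`, verbatim: a regular
algebraic cuspidal `π` on `GL₄/ℚ` unramified at `ℓ`, ANY level away from `ℓ`, FL weight).  It is
the sibling crux `SerreGSp4Surjective` (K1) with its ordinary local clause (H2) replaced by the
FL clause and its ordinary conclusion replaced by the FL one; K1 ⇐ `C⁺` + Gee–Geraghty 2012
Thm. 7.5.2, and (this card) the wreath crux ⇐ `C⁺` + printed machinery. -/
def SerreGSp4SurjectiveFL : Prop :=
  ∃ ℓ₀ : ℕ, ∀ (ℓ : ℕ) [Fact ℓ.Prime], ℓ₀ ≤ ℓ → ∀ ρ' : FramedGaloisRep ℚ (ZMod ℓ) 4,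
    FullSymplecticImage ℓ ρ' →
    (∃ (r₀ : FramedGaloisRep ℚ (PadicAlgCl ℓ) 4) (wts : Multiset ℤ) (lo hi : ℤ),
      wts.Nodup ∧ hi - lo + 2 ≤ (ℓ : ℤ) ∧ (∀ h ∈ wts, lo ≤ h ∧ h ≤ hi) ∧
      r₀.IsSymplecticWithMultiplierFun (cycInv ℓ) ∧
      (∀ᶠ v : HeightOneSpectrum (𝓞 ℚ) in Filter.cofinite, r₀.IsUnramifiedAt v) ∧
      IsCrystallineWithWeightsAt ℓ wts r₀ ∧ ReducesTo ℓ r₀ ρ') →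
    ResiduallyAutomorphic ℓ ρ'

/-! ## Card `siegel-eisenstein-boundary` -/

/-- **FIRST LEMMA (Calegari's parallel-weight theorem ⇒ no regular induced lifts for imaginary
`K`).**  Over an IMAGINARY quadratic `K`, if `σ : Γ_K → GL₂(ℚ̄_p)` has `Ind_K^ℚ σ` irreducible
(`σ ≄ σ^c`) and symplectic for some multiplier, then `Ind_K^ℚ σ` is NOT Greenberg-ordinary of
injective shape at `p`.  (Essential self-duality forces `det σ = ν|_K` Galois-invariant or
`σ^c ≅ σ^∨ν` — the latter excluded projectively by `σ ≄ σ^c ⊗ χ` in the wreath case; for `p`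
split this is the vendored fact `Calegari2010_thm_1_4` (equal ordinary gaps `m = n` at the two
places) plus `det σ = (det σ)^c`, giving the repeated multiset `{a, a, a+m, a+m}`.)  CONSEQUENCE:
for imaginary `K` every witness `r` of the crux's conclusion is a STABLE (non-endoscopic,
non-induced) form congruent to the theta-lift residue — the crux's imaginary half is a Yoshida-type
CONGRUENCE statement, and no `GL₂/K` Hida family can supply it. -/
def NoRegularInducedLiftImaginary : Prop :=
  ∀ (p : ℕ) [Fact p.Prime] (K : Type) [Field K] [NumberField K] (hK : Module.finrank ℚ K = 2),
    NumberField.IsTotallyComplex K →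
    ∀ (σ : FramedGaloisRep K (PadicAlgCl p) 2) (ν : absoluteGaloisGroup ℚ → PadicAlgCl p),
      (σ.induce ℚ hK).toGaloisRep.IsIrreducible →
      (σ.induce ℚ hK).IsSymplecticWithMultiplierFun ν →
      ∀ v : HeightOneSpectrum (𝓞 ℚ), ((p : ℕ) : 𝓞 ℚ) ∈ v.asIdeal →
        ∀ a : Fin 4 → ℕ, (σ.induce ℚ hK).IsGreenbergOrdinaryOfShapeAt v a → ¬ Function.Injective a

/-- **TORSION-SERRE OVER CM FIELDS for the wreath constituent (the imaginary line's OPEN input, in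
Scholze's vocabulary — the CONVERSE direction of the vendored `Scholze2015_galoisRep_of_modPEigensystem`
for `n = 2`).**  For a CM field `F` and an absolutely irreducible `σ̄_F : Γ_F → GL₂(k)` (`k`
algebraically closed of characteristic `p`, discrete; in the line `σ̄_F = σ̄|_{Γ_F}` for the wreath
constituent `σ̄ : Γ_K → GL₂(k)` and `F = K·L⁺` CM with `[F⁺:ℚ] ≥ 2`), unramified outside a finite
conjugation-stable `S ∋ (v ∣ p)`, there are a level `K_S · ∏_{v ∉ S} GL₂(𝒪_v)`, a degree `i` and a
system of Hecke eigenvalues `a` OCCURRING in `H^i(X_K, k)` (`HeckeEigenvaluesOccurGL`, possibly a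
TORSION class) whose Scholze polynomials are the reversed characteristic polynomials of `σ̄_F` at
every `v ∉ S`.  (The ordinary refinement — occurrence in the ORDINARY part at Iwahori level — is
what the seed step consumes; it is not typed here.) -/
def TorsionSerreCM : Prop :=
  ∀ (F : Type) [Field F] [NumberField F], NumberField.IsCMField F →
  ∀ (p : ℕ) [Fact p.Prime] (k : Type) [Field k] [CharP k p] [IsAlgClosed k] [TopologicalSpace k]
    [DiscreteTopology k] (σF : FramedGaloisRep F k 2) (S : Finset (HeightOneSpectrum (𝓞 F))),
    (∀ v : HeightOneSpectrum (𝓞 F), ((p : ℕ) : 𝓞 F) ∈ v.asIdeal → v ∈ S) →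
    (∀ τ : F ≃ₐ[NumberField.maximalRealSubfield F] F, ∀ v ∈ S, τ • v ∈ S) →
    (∀ v : HeightOneSpectrum (𝓞 F), v ∉ S → σF.IsUnramifiedAt v) →
    FramedRep.IsAbsolutelyIrreducible σF →
    ∃ (K : Subgroup (GL (Fin 2) (FiniteAdeleRing (𝓞 F) F)))
      (ϖ : ∀ v : HeightOneSpectrum (𝓞 F), (v.adicCompletion F)ˣ) (i : ℕ)
      (a : HeightOneSpectrum (𝓞 F) → ℕ → k),
      IsOpen (K : Set (GL (Fin 2) (FiniteAdeleRing (𝓞 F) F))) ∧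
      K ≤ glFiniteIntegralLevel 2 F ∧
      (∀ g ∈ glFiniteIntegralLevel 2 F,
        (∀ v ∈ S, ∀ i j : Fin 2,
          ((g : Matrix (Fin 2) (Fin 2) (FiniteAdeleRing (𝓞 F) F)) i j) v =
            (1 : Matrix (Fin 2) (Fin 2) (v.adicCompletion F)) i j) → g ∈ K) ∧
      HeckeEigenvaluesOccurGL 2 F k S K ϖ i a ∧
      ∀ v : HeightOneSpectrum (𝓞 F), v ∉ S → ∀ 𝔓 ∈ v.primesAbove, ∀ τ : absoluteGaloisGroup F,
        IsArithFrobAt (𝓞 F) τ 𝔓 →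
          ((σF τ⁻¹ : GL (Fin 2) k) : Matrix (Fin 2) (Fin 2) k).charpolyRev =
            scholzeHeckePolynomial 2 v.residueCard (a v)

end

end Summit.Langlands.Langlands.Cruxes.SerreGSp4WreathFixed.Sketch
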